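import Literature.NumberTheory.Sieve.SmoothTwistedSaddleWindow2
import HarnessLib

/-!
# The twisted saddle point at the scales `x/e`: kernel decay beyond the frequency

Topic `Literature/NumberTheory/Sieve`; a PROVED tool file complementing `SmoothTwistedSaddleWindow2`
([HildebrandTenenbaum1986, §4 (Lemmas 10–11)], [Harper2016, §5]). In
`TwistedWeight.norm_scaledSum_sub_main_le_window₂` the tail `|t| > T` of the Perron-type integral is
controlled by the crude decay `‖Ŵ_λ(α+it)‖ ≤ C_λ/|t|³`, `C_λ = 2 + 6X + 6X² + X³`, `X = 2π|λ|`
(`TwistedWeight.norm_twistMellin_le_decay`), which costs `2πC_λ/T²` and forces `T ≫ Λ²` when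
`|λ| ≤ Λ`. For frequencies as large as a power of `y` this exceeds the range in which the decay of
`ζ(α+it,y)/ζ(α,y)` is available, so we sharpen the large-`|t|` behaviour:

* `norm_twistMellin_le_decay₂`: `‖Ŵ_λ(s)‖ ≤ (2 + 6X + 6X² + X³·C_λ/(‖s+5‖‖s+6‖‖s+7‖))/(‖s+2‖‖s+3‖‖s+4‖)`
  (in the third integration by parts the top-order piece `c³(1−v)²e(λv)` of the amplitude integrates
  to `c³Ŵ_λ(s+3)`, bounded by the crude decay at `s+3`): for `|Im s| ≥ T` the `X³` is damped by
  `C_λ/T³`;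
* `scaledKernel_decay₂`: the resulting bound `‖A_{λ,e}(t)‖ ≤ e^{−α}(2 + 6X + 6X² + X³C_λ/T³)/|t|³`
  for `|t| > T ≥ 3`;
* `norm_scaledSum_sub_main_le_window₂_decay`: `norm_scaledSum_sub_main_le_window₂` with the kernel
  decay constant as a PARAMETER `C₃` (hypothesis `‖A_{λ,e}(t)‖ ≤ e^{−α}C₃/|t|³` for `|t| > T`, last
  error term `2πC₃/T²`).

With `T ≍ Λ^{3/2} log x` this is what the long-range (`|λ| ≤ y⁷`) quantitative window theorem
`SmoothTwistedSaddleWindowLong` needs.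

## References

* A. Hildebrand, G. Tenenbaum, Trans. AMS 296 (1986), §4 (Lemmas 10–11) [HildebrandTenenbaum1986].
* A. J. Harper, Compositio Math. 152 (2016), §5 [Harper2016].
-/

noncomputable section

open Real Complex MeasureTheory Set Filter
open scoped FourierTransform Topology

namespace Literature.NumberTheory.Sieve

namespace TwistedWeight

/-! ### The Mellin transform: iterated decay -/

set_option maxHeartbeats 800000 in
/-- **Iterated decay in `|s|`.** For `Re s > 0`, with `X = 2π|λ|` and `C_λ = 2 + 6X + 6X² + X³`:
`‖Ŵ_λ(s)‖ ≤ (2 + 6X + 6X² + X³·C_λ/(‖s+5‖‖s+6‖‖s+7‖))/(‖s+2‖‖s+3‖‖s+4‖)`. As in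
`norm_twistMellin_le_decay` (three integrations by parts in `v^{s+k}`), but the top-order piece
`c³(1−v)²e^{cv}` (`c = 2πiλ`) of the third derivative of the amplitude integrates against `v^{s+4}`
to `c³Ŵ_λ(s+3)`, which is bounded by the crude decay bound at `s+3` instead of by `X³`. [folklore] -/
theorem norm_twistMellin_le_decay₂ {s : ℂ} (hs : 0 < s.re) (lam : ℝ) :
    ‖twistMellin lam s‖ ≤ (2 + 6 * (2 * π * |lam|) + 6 * (2 * π * |lam|) ^ 2 + (2 * π * |lam|) ^ 3 *
        ((2 + 6 * (2 * π * |lam|) + 6 * (2 * π * |lam|) ^ 2 + (2 * π * |lam|) ^ 3) /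
          (‖s + 5‖ * ‖s + 6‖ * ‖s + 7‖))) / (‖s + 2‖ * ‖s + 3‖ * ‖s + 4‖) := by
  set c : ℂ := 2 * π * I * lam with hc
  have hcn : ‖c‖ = 2 * π * |lam| := by
    rw [hc, norm_mul, norm_mul, norm_mul, Complex.norm_I, mul_one, Complex.norm_real, Complex.norm_ofNat,
      Complex.norm_real, Real.norm_eq_abs, Real.norm_eq_abs, abs_of_pos Real.pi_pos]
  -- the amplitudes, `g‴ = p + c³ g₀`
  set g0 : ℝ → ℂ := fun v => ((((1 - v) ^ 2 : ℝ)) : ℂ) * Complex.exp (c * v) with hg0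
  set g1 : ℝ → ℂ := fun v => ((((-(2 * (1 - v))) : ℝ) : ℂ) + c * ((((1 - v) ^ 2 : ℝ)) : ℂ)) *
    Complex.exp (c * v) with hg1
  set g2 : ℝ → ℂ := fun v => ((2 : ℂ) + (2 * c * ((((-(2 * (1 - v))) : ℝ) : ℂ)) + c ^ 2 * ((((1 - v) ^ 2 : ℝ)) : ℂ))) *
    Complex.exp (c * v) with hg2
  set g3 : ℝ → ℂ := fun v => (6 * c + (3 * c ^ 2 * ((((-(2 * (1 - v))) : ℝ) : ℂ)) + c ^ 3 * ((((1 - v) ^ 2 : ℝ)) : ℂ))) *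
    Complex.exp (c * v) with hg3
  set p : ℝ → ℂ := fun v => (6 * c + 3 * c ^ 2 * ((((-(2 * (1 - v))) : ℝ) : ℂ))) * Complex.exp (c * v) with hp
  have hsub : ∀ v : ℝ, HasDerivAt (fun x : ℝ => 1 - x) (-1) v := fun v => by
    simpa using (hasDerivAt_id v).const_sub 1
  have hsq : ∀ v : ℝ, HasDerivAt (fun x : ℝ => ((((1 - x) ^ 2 : ℝ)) : ℂ)) ((((-(2 * (1 - v))) : ℝ) : ℂ)) v := by
    intro v
    have h4 := (hasDerivAt_pow 2 (1 - v)).comp v (hsub v)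
    have h5 : HasDerivAt (fun x : ℝ => (1 - x) ^ 2) (-(2 * (1 - v))) v := by
      refine HasDerivAt.congr_deriv (h4.congr_of_eventuallyEq (Filter.Eventually.of_forall fun x => rfl)) ?_
      push_cast; ring
    exact h5.ofReal_comp
  have hlin : ∀ v : ℝ, HasDerivAt (fun x : ℝ => ((((-(2 * (1 - x))) : ℝ) : ℂ))) (2 : ℂ) v := by
    intro v
    have h5 : HasDerivAt (fun x : ℝ => -(2 * (1 - x))) 2 v := by
      have := (hsub v).const_mul 2 |>.neg
      refine this.congr_deriv ?_; ring
    have := h5.ofReal_comp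
    simpa using this
  have hd0 : ∀ v, HasDerivAt g0 (g1 v) v := by
    intro v
    have := hasDerivAt_poly_mul_exp c (hsq v)
    rw [hg0, hg1]
    exact this
  have hd1 : ∀ v, HasDerivAt g1 (g2 v) v := by
    intro v
    have hP : HasDerivAt (fun x : ℝ => ((((-(2 * (1 - x))) : ℝ) : ℂ) + c * (((1 - x) ^ 2 : ℝ) : ℂ)))
        ((2 : ℂ) + c * (((-(2 * (1 - v))) : ℝ) : ℂ)) v := (hlin v).add ((hsq v).const_mul c)
    have := hasDerivAt_poly_mul_exp c hP
    rw [hg1, hg2]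
    refine this.congr_deriv ?_
    ring
  have hd2 : ∀ v, HasDerivAt g2 (g3 v) v := by
    intro v
    have hP : HasDerivAt (fun x : ℝ => (2 : ℂ) + (2 * c * (((-(2 * (1 - x))) : ℝ) : ℂ) + c ^ 2 * (((1 - x) ^ 2 : ℝ) : ℂ)))
        (2 * c * 2 + c ^ 2 * (((-(2 * (1 - v))) : ℝ) : ℂ)) v :=
      (((hlin v).const_mul (2 * c)).add ((hsq v).const_mul (c ^ 2))).const_add (2 : ℂ)
    have := hasDerivAt_poly_mul_exp c hP
    rw [hg2, hg3]
    refine this.congr_deriv ?_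
    ring
  -- continuity
  have hg0c : Continuous g0 := continuous_iff_continuousAt.mpr fun v => (hd0 v).differentiableAt.continuousAt
  have hg1c : Continuous g1 := continuous_iff_continuousAt.mpr fun v => (hd1 v).differentiableAt.continuousAt
  have hg2c : Continuous g2 := continuous_iff_continuousAt.mpr fun v => (hd2 v).differentiableAt.continuousAt
  have hg3c : Continuous g3 := by rw [hg3]; fun_prop
  have hpc : Continuous p := by rw [hp]; fun_prop
  -- the three integrations by parts
  have hs1 : 0 < (s + 1).re := by simp; linarith
  have hs2 : 0 < (s + 2).re := by simp; linarith
  have hs3 : 0 < (s + 3).re := by simp; linarith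
  have hs4 : 0 < (s + 4).re := by simp; linarith
  have e0 : ∀ w : ℂ, twistMellin lam w = ∫ v in (0 : ℝ)..1, (v : ℂ) ^ (w + 1) * g0 v := by
    intro w
    unfold twistMellin
    refine intervalIntegral.integral_congr fun v _ => ?_
    simp only [hg0, hc]
    rw [mul_assoc]
    congr 1
    congr 1
    rw [Real.fourierChar_apply]; congr 1; push_cast; ring
  have e1 := integral_cpow_mul_parts hs1 hd0 hg1c
  have e2 := integral_cpow_mul_parts hs2 hd1 hg2c
  have e3 := integral_cpow_mul_parts hs3 hd2 hg3c
  have hg0_1 : g0 1 = 0 := by simp [hg0]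
  have hg1_1 : g1 1 = 0 := by simp [hg1]
  have hg2_1 : g2 1 = 2 * Complex.exp c := by simp [hg2]
  rw [show s + 1 + 1 = s + 2 by ring] at e1
  rw [show s + 2 + 1 = s + 3 by ring] at e2
  rw [show s + 3 + 1 = s + 4 by ring] at e3
  rw [hg0_1, zero_div, zero_sub] at e1
  rw [hg1_1, zero_div, zero_sub] at e2
  rw [hg2_1] at e3
  have hW : twistMellin lam s = (1 / (s + 2)) * ((1 / (s + 3)) *
      (2 * Complex.exp c / (s + 4) - (1 / (s + 4)) * ∫ v in (0 : ℝ)..1, (v : ℂ) ^ (s + 4) * g3 v)) := by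
    rw [e0 s, e1, e2, e3]; ring
  -- `∫ v^{s+4} g‴ = ∫ v^{s+4} p + c³ Ŵ_λ(s+3)`
  have hsplit : ∫ v in (0 : ℝ)..1, (v : ℂ) ^ (s + 4) * g3 v =
      (∫ v in (0 : ℝ)..1, (v : ℂ) ^ (s + 4) * p v) + c ^ 3 * twistMellin lam (s + 3) := by
    have i1 : IntervalIntegrable (fun v : ℝ => (v : ℂ) ^ (s + 4) * p v) volume 0 1 :=
      ((continuous_ofReal_cpow hs4).mul hpc).intervalIntegrable 0 1
    have i2 : IntervalIntegrable (fun v : ℝ => c ^ 3 * ((v : ℂ) ^ (s + 4) * g0 v)) volume 0 1 :=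
      (continuous_const.mul ((continuous_ofReal_cpow hs4).mul hg0c)).intervalIntegrable 0 1
    calc ∫ v in (0 : ℝ)..1, (v : ℂ) ^ (s + 4) * g3 v
        = ∫ v in (0 : ℝ)..1, ((v : ℂ) ^ (s + 4) * p v + c ^ 3 * ((v : ℂ) ^ (s + 4) * g0 v)) := by
          refine intervalIntegral.integral_congr fun v _ => ?_
          simp only [hg3, hp, hg0]; ring
      _ = (∫ v in (0 : ℝ)..1, (v : ℂ) ^ (s + 4) * p v) + c ^ 3 * ∫ v in (0 : ℝ)..1, (v : ℂ) ^ (s + 4) * g0 v := by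
          rw [intervalIntegral.integral_add i1 i2, intervalIntegral.integral_const_mul]
      _ = _ := by rw [e0 (s + 3), show s + 3 + 1 = s + 4 by ring]
  -- the bounds
  have hne2 : s + 2 ≠ 0 := by intro h; have := congrArg Complex.re h; simp at this; linarith
  have hne3 : s + 3 ≠ 0 := by intro h; have := congrArg Complex.re h; simp at this; linarith
  have hne4 : s + 4 ≠ 0 := by intro h; have := congrArg Complex.re h; simp at this; linarith
  have hpb : ∀ v ∈ Ioc (0 : ℝ) 1, ‖(v : ℂ) ^ (s + 4) * p v‖ ≤ 6 * (2 * π * |lam|) + 6 * (2 * π * |lam|) ^ 2 := by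
    intro v hv
    obtain ⟨hv0, hv1⟩ := hv
    have hpow : ‖(v : ℂ) ^ (s + 4)‖ ≤ 1 := by
      rw [Complex.norm_cpow_eq_rpow_re_of_pos hv0]
      exact Real.rpow_le_one hv0.le hv1 (by simp; linarith)
    have hE : ‖Complex.exp (c * v)‖ = 1 := by rw [hc]; exact norm_exp_twoPiI_mul lam v
    have hA : ‖((((-(2 * (1 - v))) : ℝ) : ℂ))‖ ≤ 2 := by
      rw [Complex.norm_real, Real.norm_eq_abs, abs_neg, abs_of_nonneg (by linarith)]; linarith
    have hpoly : ‖6 * c + 3 * c ^ 2 * ((((-(2 * (1 - v))) : ℝ) : ℂ))‖ ≤ 6 * (2 * π * |lam|) + 6 * (2 * π * |lam|) ^ 2 := by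
      calc ‖6 * c + 3 * c ^ 2 * ((((-(2 * (1 - v))) : ℝ) : ℂ))‖ ≤ ‖6 * c‖ + ‖3 * c ^ 2 * ((((-(2 * (1 - v))) : ℝ) : ℂ))‖ :=
            norm_add_le _ _
        _ ≤ 6 * ‖c‖ + 3 * ‖c‖ ^ 2 * 2 := by
            have e1 : ‖(6 : ℂ) * c‖ = 6 * ‖c‖ := by rw [norm_mul (6 : ℂ) c, Complex.norm_ofNat]
            have e2 : ‖(3 : ℂ) * c ^ 2 * ((((-(2 * (1 - v))) : ℝ) : ℂ))‖ ≤ 3 * ‖c‖ ^ 2 * 2 := by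
              rw [norm_mul ((3 : ℂ) * c ^ 2) _, norm_mul (3 : ℂ) (c ^ 2), norm_pow c 2, Complex.norm_ofNat]
              exact mul_le_mul_of_nonneg_left hA (by positivity)
            rw [e1]
            exact add_le_add le_rfl e2
        _ = _ := by rw [hcn]; ring
    rw [norm_mul, hp]
    simp only
    rw [norm_mul, hE, mul_one]
    calc ‖(v : ℂ) ^ (s + 4)‖ * ‖6 * c + 3 * c ^ 2 * ((((-(2 * (1 - v))) : ℝ) : ℂ))‖
        ≤ 1 * (6 * (2 * π * |lam|) + 6 * (2 * π * |lam|) ^ 2) := mul_le_mul hpow hpoly (norm_nonneg _) zero_le_one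
      _ = _ := one_mul _
  have hint : ‖∫ v in (0 : ℝ)..1, (v : ℂ) ^ (s + 4) * p v‖ ≤ 6 * (2 * π * |lam|) + 6 * (2 * π * |lam|) ^ 2 := by
    have := intervalIntegral.norm_integral_le_of_norm_le_const (a := (0 : ℝ)) (b := 1)
      (f := fun v : ℝ => (v : ℂ) ^ (s + 4) * p v) (C := 6 * (2 * π * |lam|) + 6 * (2 * π * |lam|) ^ 2)
      (fun v hv => by rw [uIoc_of_le zero_le_one] at hv; exact hpb v hv)
    simpa using this
  have htail : ‖c ^ 3 * twistMellin lam (s + 3)‖ ≤ (2 * π * |lam|) ^ 3 *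
      ((2 + 6 * (2 * π * |lam|) + 6 * (2 * π * |lam|) ^ 2 + (2 * π * |lam|) ^ 3) / (‖s + 5‖ * ‖s + 6‖ * ‖s + 7‖)) := by
    rw [norm_mul, norm_pow, hcn]
    apply mul_le_mul_of_nonneg_left _ (by positivity)
    have h := norm_twistMellin_le_decay hs3 lam
    rwa [show s + 3 + 2 = s + 5 by ring, show s + 3 + 3 = s + 6 by ring, show s + 3 + 4 = s + 7 by ring] at h
  have hexp1 : ‖Complex.exp c‖ = 1 := by
    have := norm_exp_twoPiI_mul lam 1; rw [← hc] at this; simpa using this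
  have hn2 : 0 < ‖s + 2‖ := norm_pos_iff.mpr hne2
  have hn3 : 0 < ‖s + 3‖ := norm_pos_iff.mpr hne3
  have hn4 : 0 < ‖s + 4‖ := norm_pos_iff.mpr hne4
  set Y : ℂ := 2 * Complex.exp c / (s + 4) - 1 / (s + 4) * ∫ v in (0 : ℝ)..1, (v : ℂ) ^ (s + 4) * g3 v with hY
  have hYb : ‖Y‖ ≤ (2 + (6 * (2 * π * |lam|) + 6 * (2 * π * |lam|) ^ 2 + (2 * π * |lam|) ^ 3 *
      ((2 + 6 * (2 * π * |lam|) + 6 * (2 * π * |lam|) ^ 2 + (2 * π * |lam|) ^ 3) / (‖s + 5‖ * ‖s + 6‖ * ‖s + 7‖)))) /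
        ‖s + 4‖ := by
    calc ‖Y‖ ≤ ‖2 * Complex.exp c / (s + 4)‖ + ‖1 / (s + 4) * ∫ v in (0 : ℝ)..1, (v : ℂ) ^ (s + 4) * g3 v‖ :=
          norm_sub_le _ _
      _ = (2 + ‖∫ v in (0 : ℝ)..1, (v : ℂ) ^ (s + 4) * g3 v‖) / ‖s + 4‖ := by
          rw [norm_div, norm_mul, Complex.norm_ofNat, hexp1, mul_one, norm_mul, norm_div, norm_one]
          ring
      _ ≤ _ := by
          gcongr
          rw [hsplit]
          exact (norm_add_le _ _).trans (add_le_add hint htail)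
  calc ‖twistMellin lam s‖ = ‖Y‖ / (‖s + 2‖ * ‖s + 3‖) := by
        rw [hW, norm_mul, norm_mul, norm_div, norm_div, norm_one]
        field_simp
    _ ≤ _ := div_le_div_of_nonneg_right hYb (by positivity)
    _ = _ := by rw [div_div]; ring

/-! ### The scaled kernel beyond the frequency -/

/-- **Kernel decay beyond the frequency**: for `|t| > T ≥ 3` (`α > 0`), with `X = 2π|λ|` and
`C_λ = 2 + 6X + 6X² + X³`: `‖A_{λ,e}(t)‖ ≤ e^{−α}(2 + 6X + 6X² + X³·C_λ/T³)/|t|³`. [folklore] -/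
theorem scaledKernel_decay₂ {α : ℝ} (hα0 : 0 < α) {e : ℕ} (he : 1 ≤ e) (lam : ℝ) {T t : ℝ} (hT : 3 ≤ T)
    (ht : T < |t|) :
    ‖scaledKernel α e lam t‖ ≤ (e : ℝ) ^ (-α) *
      (2 + 6 * (2 * π * |lam|) + 6 * (2 * π * |lam|) ^ 2 + (2 * π * |lam|) ^ 3 *
        ((2 + 6 * (2 * π * |lam|) + 6 * (2 * π * |lam|) ^ 2 + (2 * π * |lam|) ^ 3) / T ^ 3)) / |t| ^ 3 := by
  have hπ0 := Real.pi_pos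
  have hCl0 : 0 ≤ 2 + 6 * (2 * π * |lam|) + 6 * (2 * π * |lam|) ^ 2 + (2 * π * |lam|) ^ 3 := by positivity
  have hT0 : 0 < T := by linarith
  have habs0 : 0 < |t| := hT0.trans ht
  have hs : 0 < ((α : ℂ) + t * I).re := by simp; exact hα0
  have hWd := norm_twistMellin_le_decay₂ hs lam
  have hge : ∀ k : ℝ, |t| ≤ ‖(α : ℂ) + t * I + k‖ := by
    intro k
    have : |((α : ℂ) + t * I + k).im| ≤ ‖(α : ℂ) + t * I + k‖ := Complex.abs_im_le_norm _
    simpa using this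
  have h2 := hge 2; have h3 := hge 3; have h4 := hge 4; have h5 := hge 5; have h6 := hge 6; have h7 := hge 7
  push_cast at h2 h3 h4 h5 h6 h7
  have h234 : |t| ^ 3 ≤ ‖(α : ℂ) + t * I + 2‖ * ‖(α : ℂ) + t * I + 3‖ * ‖(α : ℂ) + t * I + 4‖ := by
    calc |t| ^ 3 = |t| * |t| * |t| := by ring
      _ ≤ _ := mul_le_mul (mul_le_mul h2 h3 (abs_nonneg _) (norm_nonneg _)) h4 (abs_nonneg _) (by positivity)
  have h567 : |t| ^ 3 ≤ ‖(α : ℂ) + t * I + 5‖ * ‖(α : ℂ) + t * I + 6‖ * ‖(α : ℂ) + t * I + 7‖ := by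
    calc |t| ^ 3 = |t| * |t| * |t| := by ring
      _ ≤ _ := mul_le_mul (mul_le_mul h5 h6 (abs_nonneg _) (norm_nonneg _)) h7 (abs_nonneg _) (by positivity)
  have hT3t : T ^ 3 ≤ |t| ^ 3 := pow_le_pow_left₀ hT0.le ht.le 3
  set N : ℝ := 2 + 6 * (2 * π * |lam|) + 6 * (2 * π * |lam|) ^ 2 + (2 * π * |lam|) ^ 3 *
    ((2 + 6 * (2 * π * |lam|) + 6 * (2 * π * |lam|) ^ 2 + (2 * π * |lam|) ^ 3) / T ^ 3) with hN
  have hN0 : 0 ≤ N := by positivity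
  have hnum : 2 + 6 * (2 * π * |lam|) + 6 * (2 * π * |lam|) ^ 2 + (2 * π * |lam|) ^ 3 *
      ((2 + 6 * (2 * π * |lam|) + 6 * (2 * π * |lam|) ^ 2 + (2 * π * |lam|) ^ 3) /
        (‖(α : ℂ) + t * I + 5‖ * ‖(α : ℂ) + t * I + 6‖ * ‖(α : ℂ) + t * I + 7‖)) ≤ N := by
    rw [hN]
    gcongr
    exact hT3t.trans h567
  rw [norm_scaledKernel he, mul_div_assoc]
  apply mul_le_mul_of_nonneg_left _ (by positivity)
  calc ‖twistMellin lam (α + t * I)‖ ≤ _ := hWd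
    _ ≤ N / (‖(α : ℂ) + t * I + 2‖ * ‖(α : ℂ) + t * I + 3‖ * ‖(α : ℂ) + t * I + 4‖) :=
        div_le_div_of_nonneg_right hnum (by positivity)
    _ ≤ N / |t| ^ 3 := div_le_div_of_nonneg_left hN0 (by positivity) h234

/-! ### The scaled twisted sum with a parametric kernel-decay constant -/

set_option maxHeartbeats 1000000 in
/-- **The twisted saddle point at the scale `x/e`, parametric window, second order, parametric kernel
decay.** `norm_scaledSum_sub_main_le_window₂` with the large-`|t|` kernel bound as a hypothesis
`‖A_{λ,e}(t)‖ ≤ e^{−α}C₃/|t|³` (`|t| > T`): with `𝓜 = x^α ζ(α,y)/√(2πφ)`, `α = α(x,y)`, `φ = φ₂(α,y)`,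
`‖S_w(λ; x/e) − e^{−α} 𝓜 Ŵ_λ(α)‖ ≤ (x^α ζ(α,y)/(2π)) e^{−α} · E₂(C₃)`, where `E₂(C₃)` is the bracket of
`norm_scaledSum_sub_main_le_window₂` with its last term `2πC_λ/T²` replaced by `2πC₃/T²`.
[cite: HildebrandTenenbaum1986, §4 (Lemmas 10–11)] [cite: Harper2016, §5] -/
theorem norm_scaledSum_sub_main_le_window₂_decay {x T ε₁ ε₂ W : ℝ} {y : ℕ} (hx : 1 < x) (hy : 2 ≤ y)
    (hα : 3 / 5 ≤ saddlePoint x y) (hα1 : saddlePoint x y ≤ 1) (hφ0 : 0 < saddlePhi₂ (saddlePoint x y) y)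
    (hW : 0 < W) (hτ : W / Real.sqrt (saddlePhi₂ (saddlePoint x y) y) ≤ Real.pi / Real.log y)
    (hy1 : Real.pi / Real.log y ≤ 1)
    (hη₂ : saddlePhi₃ (saddlePoint x y) y / 6 * (W / Real.sqrt (saddlePhi₂ (saddlePoint x y) y)) ^ 3 +
      saddlePhi₄ (saddlePoint x y) y * (W / Real.sqrt (saddlePhi₂ (saddlePoint x y) y)) ^ 4 ≤ 1)
    (hT : 3 ≤ T) (hε₁ : 0 ≤ ε₁) (hε₂ : 0 ≤ ε₂)
    (hdec1 : ∀ t : ℝ, Real.pi / Real.log y ≤ |t| → |t| ≤ 3 →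
      ‖smoothZetaC ((saddlePoint x y : ℂ) + t * I) y‖ / smoothZeta (saddlePoint x y) y ≤ ε₁)
    (hdec2 : ∀ t : ℝ, 3 ≤ |t| → |t| ≤ T →
      ‖smoothZetaC ((saddlePoint x y : ℂ) + t * I) y‖ / smoothZeta (saddlePoint x y) y ≤ ε₂)
    {e : ℕ} (he : 1 ≤ e) (lam : ℝ) {C₃ : ℝ} (hC₃ : 0 ≤ C₃)
    (hB3 : ∀ t : ℝ, T < |t| → ‖scaledKernel (saddlePoint x y) e lam t‖ ≤ (e : ℝ) ^ (-saddlePoint x y) * C₃ / |t| ^ 3) :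
    ‖(∑ n ∈ Nat.smoothNumbersUpTo ⌊x / e⌋₊ (y + 1), twistWeight lam (n / (x / e))) -
        ((((e : ℝ) ^ (-saddlePoint x y) * (x ^ saddlePoint x y * smoothZeta (saddlePoint x y) y /
            Real.sqrt (2 * Real.pi * saddlePhi₂ (saddlePoint x y) y)) : ℝ)) : ℂ) * twistMellin lam (saddlePoint x y)‖ ≤
      (x ^ saddlePoint x y * smoothZeta (saddlePoint x y) y / (2 * Real.pi)) * (e : ℝ) ^ (-saddlePoint x y) *
        (2 / (1 + |lam|) * (Real.exp (-(W ^ 2 / 4)) * Real.sqrt (4 * Real.pi / saddlePhi₂ (saddlePoint x y) y)) +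
          Real.sqrt (4 * Real.pi / saddlePhi₂ (saddlePoint x y) y) *
            ((2 * (Real.log e + 3) ^ 2 +
              (2 + 2 * Real.log e) * (15 * Real.log y + 666 * Real.log y ^ 2 *
                (W / Real.sqrt (saddlePhi₂ (saddlePoint x y) y))) +
              916 * Real.log y ^ 2 + 7000000 * Real.log y ^ 4 / saddlePhi₂ (saddlePoint x y) y) /
              (saddlePhi₂ (saddlePoint x y) y * (1 + |lam|))) +
          ((2 / (1 + |lam|)) * Real.exp (-(W ^ 2 / 140)) * Real.sqrt (125 * Real.pi ^ 3 / saddlePhi₂ (saddlePoint x y) y) +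
            20 * Real.pi * ε₁ / (saddlePoint x y * (1 + |lam|)) + 2 * Real.pi * ε₂ * T +
            2 * Real.pi * C₃ / T ^ 2)) := by
  set α : ℝ := saddlePoint x y with hαdef
  have hα0 : 0 < α := by linarith
  have hα12 : 1 / 2 ≤ α := by linarith
  set φ : ℝ := saddlePhi₂ α y with hφ
  have hx0 : 0 < x := by linarith
  have he0 : 0 < e := he
  have he0' : (0 : ℝ) < e := by exact_mod_cast he0
  have hloge : 0 ≤ Real.log e := Real.log_nonneg (by exact_mod_cast he)
  set c : ℝ := x ^ α * smoothZeta α y / (2 * Real.pi) with hc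
  have hc0 : 0 < c := by have := smoothZeta_pos (y := y) hα0; have := Real.pi_pos; positivity
  set ρ : ℝ := (e : ℝ) ^ (-α) with hρ
  have hρ0 : 0 < ρ := Real.rpow_pos_of_pos he0' _
  -- the kernel constants
  set b₀ : ℝ := 2 * ρ / (1 + |lam|) with hb₀
  set b₁ : ℝ := (2 + 2 * Real.log e) * ρ / (1 + |lam|) with hb₁
  set b₂ : ℝ := 2 * (Real.log e + 3) ^ 2 * ρ / (1 + |lam|) with hb₂
  have hB0 : ∀ t : ℝ, |t| ≤ 3 → ‖scaledKernel α e lam t‖ ≤ b₀ := fun t ht =>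
    scaledKernel_norm_le_three hα0 hα1 he lam ht
  have hB1 : ∀ t : ℝ, |t| ≤ 1 → ‖scaledKernel α e lam t - scaledKernel α e lam 0‖ ≤ b₁ * |t| := fun t ht =>
    scaledKernel_sub_zero_le hα12 hα1 he lam ht
  have hB2 : ∀ t : ℝ, |t| ≤ 1 → ‖scaledKernel α e lam t + scaledKernel α e lam (-t) - 2 * scaledKernel α e lam 0‖ ≤
      b₂ * t ^ 2 := fun t _ => scaledKernel_symmDiff_le hα12 hα1 he lam t
  have hBall : ∀ t : ℝ, ‖scaledKernel α e lam t‖ ≤ ρ := fun t => scaledKernel_norm_le hα0 he lam t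
  have hB3' : ∀ t : ℝ, T < |t| → ‖scaledKernel α e lam t‖ ≤ ρ * C₃ / |t| ^ 3 := hB3
  have hK := SaddleKernel.norm_kernelIntegral_sub_main_le_window₂' hx hy hα hα1 hφ0 hW hτ hy1 hη₂ hT hε₁ hε₂ hdec1
    hdec2 (continuous_scaledKernel hα0 he0 lam) (integrable_scaledKernel hα0 he0 lam) (by positivity)
    (by positivity) (by positivity) hρ0.le (by positivity) hB0 hB1 hB2 hBall hB3'
  rw [← hαdef, ← hφ] at hK
  -- `S_w(λ; x/e) = c ∫ f`, `𝓜 = c √(2π/φ)`, `A 0 = e^{-α} Ŵ_λ(α)`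
  have hS := scaledSum_eq_integral hx0 hα0 y he0 lam
  have hA0 : scaledKernel α e lam 0 = (ρ : ℂ) * twistMellin lam α := scaledKernel_zero he lam
  rw [hA0] at hK
  have hmain : x ^ α * smoothZeta α y / Real.sqrt (2 * Real.pi * φ) = c * Real.sqrt (2 * Real.pi / φ) := by
    rw [hc, SaddleKernel.main_const_identity hφ0]
  rw [hmain, hS]
  have halg : (c : ℂ) * (∫ t, scaledIntegrand x α y e lam t) -
      (((ρ * (c * Real.sqrt (2 * Real.pi / φ)) : ℝ)) : ℂ) * twistMellin lam α =
      (c : ℂ) * ((∫ t, SaddleKernel.kernelIntegrand x α y (scaledKernel α e lam) t) -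
        (ρ : ℂ) * twistMellin lam α * (Real.sqrt (2 * Real.pi / φ) : ℂ)) := by
    simp only [scaledIntegrand]
    push_cast; ring
  rw [halg, norm_mul, Complex.norm_real, Real.norm_eq_abs, abs_of_pos hc0]
  rw [show ∀ B : ℝ, c * ρ * B = c * (ρ * B) from fun B => mul_assoc _ _ _]
  apply mul_le_mul_of_nonneg_left (hK.trans (le_of_eq _)) hc0.le
  -- compare the two error expressions (an identity)
  have hl : 0 < 1 + |lam| := by positivity
  rw [hb₀, hb₁, hb₂]
  field_simp
  ring

end TwistedWeight

end Literature.NumberTheory.Sieve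

end
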